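import Summits.QuantumFields.YangMills.Theorems.BalabanUVNodesN12AtRecord13OfResiduals
import Literature.MathematicalPhysics.QuantumFieldTheory.Balaban1983to89.Node00.Record13CarriersCoPH
import Literature.MathematicalPhysics.QuantumFieldTheory.Balaban1983to89.Node00.Record13SepCoPRInhabitedOfSepCoP

/-!
# BalabanUVNodes ∕ N12 — N12's STAGE-13 STOREY AT THE v1.7 `CoPH` CORE RECORD (node00-def-T FILE 27 `Node00/Record13CoPH`, p537939: `structure Stage13HParams extends Stage13RParams`
# with the HISTORY-INDEXED residual 𝐓-weight slot `Zh p n Ω Λ` and the history-indexed §2 smearing slot `Phih` — FINDING №9 ∕ director-ym №183 H1ʰ, DESIGN (α) №186, PRESS WORD №190;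
# rev 24, cluster K1: K1⁷ `StabilityBAtRecordR13SepCoPH` — the ⁶ key stmt-QuantumFields-20507 STANDS until «KEY-24 SERVED») — the T₇ token image (`Stage13RParams ↦ Stage13HParams`,
# `CoPR ↦ CoPH`, `ZrUnity ↦ ZhUnity`; generator `work/mk_coph.py` over the TREE text) of this seat's 12U `BalabanUVNodesN12AtRecord13CoPR` (p533452): `IsRecordOfRecord₁₃CCoPH` ∕
# `datumOfRecord₁₃CoPH` ∕ `toStage5₁₃CoPH` over dag-n10-d's H-LEVEL PINS (`Record13CarriersCoPH` p539476: `Stage13HParams.pinW`, `Provisos₁₃CoPH.pinW`, `datumOfRecord₁₃CoPH_pinW` rfl,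
# `toStage5₁₃CoPH_pinW` rfl), the live layer at the H-EXTENSION `⟨⟨Θ.liveRepin₁₃, Zr⟩, Zh, Phih⟩` (dag-n11-e's convention: ALL THREE SLOTS FREE) and at the DOOR-CURED PIN
# `Stage13HParams.ofHistoryBlind F N (Stage13RParams.ofCured F N (Θ.liveRepin₁₃ F N))` (node00-def-T FILE 27 §H1 door ∘ node00-def-K0a FILE 18 cured pin: `ZhUnity` ⟸ `ZrUnity.ofHistoryBlind` ⟸
# `zrUnity_ofCured`; `Provisos₁₃CoPH` ⟸ `Provisos₁₃CoPR.ofHistoryBlind` ⟸ `Provisos₁₃Core.ofCured`) (Track A, DAG node N12 = [B15, Balaban1989LargeFieldI] CMP **122** (1989) 175–202;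
# seat `pub-ymgap-dag-n12-d` g12 (R134 s2 «knit at the record»), 2026-08-27; count-neutral, NOT a discharge)

HONEST FRAMING.  Count-neutral kernel COMPOSITION BY NAME — every proof term is the v1.6 one under T₇ plus the `rfl` ∕ `Iff.rfl` ∕ one-way door faces of FILE 27 §H1.  «for every admissible
v1.7 Stage-13 package and every residual layer whose bundle of record carries the leaf BELOW THE TORUS, the W-pinned world at the C-binding is an `IsRecordOfRecord₁₃CCoPH` record of
`datumOfRecord₁₃CoPH θ h` with `Dag.B15_main` at every run» restates N12's leaf inside NODE 00's record; it proves nothing of [IV].  N12'S ROWS NEED NO PORT: NODE 00's bundle of record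
`WOfRecord₁₃`, the pre-𝐑 representation `reprTOfRecord₁₃` and the coupling history `gOfRecord₁₃` read `θ.toStage13Params` and are NOT re-issued at v1.7 (KEYMAP v1.7 §NOT RE-ISSUED), and
`(⟨⟨Θ.liveRepin₁₃, Zr⟩, Zh, Phih⟩ : Stage13HParams).toStage13Params = Θ.liveRepin₁₃` by `rfl` — so 12E's proviso-free ★★ row `b15Leaf_WOfRecord₁₃_liveRepin₁₃_of_massLive_of_hasResiduals`
serves the H-extension verbatim and N12 reads NO 𝐓-weight (neither `Zr` nor `Zh` nor `Phih`); the v1.7 package `h : Provisos₁₃CoPH` enters the datum and the record predicate ONLY.  THE MIXED W-PIN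
(12J §3): below the torus (`λ.kSel P < P.K`) `W₀ P` IS the bundle of record, elsewhere the degenerate leaf-carrier (g4 `exists_printedCarriers15_b15Leaf`; at `K = 0` print applies no basic step).
The rung-1 ∃-shapes of §3–§5 carry N12's conjunct `∀ P, Dag.B15_main (leavesP w P)` ONLY (NOT `Nodes`, NOT the stub); the slots guard `SlotsNondegenerate₁₃` is a theorem of K0b's residuals
(K0a FILE 9 v1.1, read through `toStage13Params`), `ZhUnity` is DISPLAYED at a generic H-extension (`hZh`) and a THEOREM at the door-cured pin.  ONE-WAY (FILE 27 §H1): the door-cured pin is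
history-BLIND — a legitimate v1.7 parameter, the image of the K0⁶ witness road (dag-lead: bridge ⁷ ⇐ ⁶), not print's history-reading weights; the generic §3 is the socket for those.
Nothing of Bałaban's is asserted or proved; NO estimate; N12 is NOT discharged; no node is discharged; counts unmoved (Track A discharged 5∕28); a re-key is not progress.  ONE finite four-torus
programme at fixed `ε = L^{-K}` — nothing continuum ∕ ℝ⁴ ∕ OS ∕ mass gap ∕ Clay.

WHAT THIS FILE GIVES (all count-neutral; T₇ twins of 12U's):
* §1 `exists_record₁₃CCoPH_pinWWorld_b15_main_of_leaf` (generic `W₀` carrying the leaf ⇒ a v1.7 core record of θ's own datum + `Dag.B15_main` everywhere), the census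
  `exists_pinWWorld_b15_main_degenerate` (the generic-`W₀` storey is junk-inhabitable — R433 species), `…_of_leafOfRecord` (W read at `WOfRecord₁₃ θ.toStage13Params λ`).
* §2 `exists_mixedPinW_record₁₃CCoPH_b15_main_of_leafBelow` — the mixed W-pin engine (no `K ≤ kSel P` leaf).
* §3 ★ `exists_mixedPinW_record₁₃CCoPH_b15_main_liveRepin₁₃H_of_massLive_of_hasResiduals` and ★★ `exists_guarded_record₁₃CCoPH_b15_main_liveRepin₁₃H_of_massLive_of_hasResiduals_below` at the
  H-extension `⟨⟨Θ.liveRepin₁₃, Zr⟩, Zh, Phih⟩` of the live re-pin of any `Θ` carrying K0b's residuals (`hZh` displayed).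
* §4 ★★ `…_ofHistoryBlind_ofCured_liveRepin₁₃_…` — at the door-cured pin: `ZhUnity` DISCHARGED; edition-side input the v1.5 core package `h : (Θ.liveRepin₁₃).Provisos₁₃Core`.
* §5 ★★★ `…_ofHistoryBlind_ofCured_theta13OfThm1C_…` — at the door-cured pin of the plan's `L`-keyed witness `θ₁₅ᶜ`.

Sources: [Balaban1989LargeFieldI] (0.2)–(0.6) p.176, Prop. 1 (1.78) p.194, (1.80) p.195, (1.89) p.198, (1.99)–(1.102) pp.200–201; [Balaban1988Convergent] (1.11) p.248, p.257, (2.20)–(2.22) p.258,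
(3.16)–(3.22) pp.268–269; [Balaban1989LargeFieldII] Thm 1 + (0.1) pp.355–356; [Balaban1985Variational] Thm 1 p.279 (witness letters only).
-/

noncomputable section

open MeasureTheory
open scoped Matrix.Norms.L2Operator

namespace Summit.QuantumFields.YangMills.BalabanUVNodes.N12AtRecord13CoPH

open Literature.MathematicalPhysics.QuantumFieldTheory.Balaban1983to89
open Literature.MathematicalPhysics.QuantumFieldTheory.Balaban1983to89.T4Continuum (T4Family)
open Literature.MathematicalPhysics.QuantumFieldTheory.Balaban1983to89.DagBinding
open Literature.MathematicalPhysics.QuantumFieldTheory.Balaban1983to89.Node00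
open B15Claim189Assembly (new189 chiPP dom)
open B15 (Prop1Printed Ineq180)
open B15.BasicStep (Claim189)
open B8Eq17ClassAkV1 (plaqsOf)
open B15RPrime1100OfRep (rPrimeDataOfSel)
open Summit.QuantumFields.YangMills.BalabanUVNodes.N12AtRecord13OfResiduals (b15Leaf_WOfRecord₁₃_liveRepin₁₃_of_massLive_of_hasResiduals)

variable {N : ℕ} [NeZero N] {F : T4Family}

/-! ## §1 N12's ₁₃ STOREY AT THE v1.7 CORE RECORD — «an `IsRecordOfRecord₁₃CCoPH` record of θ's OWN `datumOfRecord₁₃CoPH` with `Dag.B15_main` at every run» at the C-binding of the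
W-PINNED Stage-13 view of an H-parameter (dag-n10-d's H-level `pinW`, W1 `Record13CarriersCoPH`), W READ AT THE BUNDLE OF RECORD -/

section Storey
variable (θ : Stage13HParams F N)

/-- **FOR EVERY ADMISSIBLE v1.7 STAGE-13 PACKAGE WITH THE CORE PROVISOS AND ANY PER-RUN [IV] BUNDLE FAMILY `W₀` CARRYING THE LEAF, THE WORLD BOUND AT THE C-BINDING OF THE W-PINNED
STAGE-13 VIEW IS A v1.7 CORE ₁₃C RECORD OF θ's OWN CORE DATUM WITH `Dag.B15_main` AT EVERY RUN** (any window `γw ∈ ]0, θ.γ]`, block size `θ.L`; the pin is UP-SIDE — dag-n10-d's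
H-level `Stage13HParams.pinW` (`onBase`: the residual slots `Zr`, `Zh`, `Phih` kept) with its CORE face `Provisos₁₃CoPH.pinW` (the datum pin `datumOfRecord₁₃CoPH_pinW` and the view identity
`toStage5₁₃CoPH_pinW` are `rfl`), `Stage13Params.pinW_admissible_iff` at `θ.toStage13Params`, node00-def-T's eight-tuple `IsRecordOfRecord₁₃CCoPH` (FILE 27); N12 reads `W₀` there: g30's
`upOfRecord₅C_pinW_rBasicStep_iff`).  HONESTY (R433 species, this seat's g4 `exists_printedCarriers15_b15Leaf`): at a GENERIC `W₀` the leaf is junk-inhabitable — the contentful instances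
read `W₀ := WOfRecord₁₃ θ.toStage13Params λ` (below).  Every v1.7 edition's package `h` reads this at `h.toCore` (same datum, `rfl`); count-neutral.
[cite: Balaban1989LargeFieldI, (0.2)–(0.6) p.176, Prop. 1 p.194; Balaban1989LargeFieldII, Thm 1 + (0.1) pp.355–356 (the record; bookkeeping)] -/
theorem exists_record₁₃CCoPH_pinWWorld_b15_main_of_leaf (h : θ.Provisos₁₃CoPH F N) (hθ : θ.Admissible F N) (W₀ : B12.RunParams → PrintedCarriers15)
    {γw : ℝ} (hγw : 0 < γw ∧ γw ≤ θ.γ) (hleaf : ∀ P, B15Leaf (W₀ P)) :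
    ∃ w : WorldP, IsRecordOfRecord₁₃CCoPH F N (datumOfRecord₁₃CoPH F N θ h) w ∧ w.γ = γw ∧ w.L = (θ.L : ℝ) ∧
      (∀ P, w.up P = upOfRecord₅C F N ((θ.pinW F N W₀).toStage5₁₃CoPH F N) P) ∧ ∀ P : B12.RunParams, Dag.B15_main (leavesP w P) := by
  obtain ⟨w₀⟩ := nonempty_worldP
  let w : WorldP :=
    { w₀ with
      C := (datumOfRecord₁₃CoPH F N θ h).C, γ := γw, L := (θ.L : ℝ), one_lt_L := by exact_mod_cast θ.hL.2,
      up := fun P => upOfRecord₅C F N ((θ.pinW F N W₀).toStage5₁₃CoPH F N) P }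
  refine ⟨w, ⟨θ.pinW F N W₀, h.pinW W₀, (Stage13Params.pinW_admissible_iff F N θ.toStage13Params W₀).2 hθ, rfl, rfl, hγw, rfl,
    fun _ => rfl⟩, rfl, rfl, fun _ => rfl, fun P => ?_⟩
  exact B15LeafKnit.b15_main_of_up (U := upOfRecord₅C F N ((θ.pinW F N W₀).toStage5₁₃CoPH F N) P) rfl
    ((upOfRecord₅C_pinW_rBasicStep_iff F N (θ.toStage5₁₃CoPH F N) W₀ P).2 (hleaf P))

/-- **CENSUS (R433 species, kernel form): THE GENERIC-`W₀` STOREY IS JUNK-INHABITABLE AT EVERY ADMISSIBLE v1.7 CORE PACKAGE** — a DEGENERATE [IV] bundle carries `B15Leaf` (this seat's g4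
`exists_printedCarriers15_b15Leaf`), so SOME `W₀` presents a v1.7 core record of `datumOfRecord₁₃CoPH θ h` with `Dag.B15_main` at every run WITHOUT any [IV] input.  Hence only the forms
with W read AT THE BUNDLE OF RECORD (below) measure N12. [cite: Balaban1989LargeFieldI, (0.2) p.176, Prop. 1 p.194 (bookkeeping: the typed conjuncts read the carrier)] -/
theorem exists_pinWWorld_b15_main_degenerate (h : θ.Provisos₁₃CoPH F N) (hθ : θ.Admissible F N) {γw : ℝ} (hγw : 0 < γw ∧ γw ≤ θ.γ) :
    ∃ (W₀ : B12.RunParams → PrintedCarriers15) (w : WorldP), IsRecordOfRecord₁₃CCoPH F N (datumOfRecord₁₃CoPH F N θ h) w ∧ w.γ = γw ∧ w.L = (θ.L : ℝ) ∧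
      (∀ P, w.up P = upOfRecord₅C F N ((θ.pinW F N W₀).toStage5₁₃CoPH F N) P) ∧ ∀ P : B12.RunParams, Dag.B15_main (leavesP w P) := by
  obtain ⟨W, hW⟩ := N12AtRecord12Pointed.exists_printedCarriers15_b15Leaf (F.P 0)
  exact ⟨fun _ => W, exists_record₁₃CCoPH_pinWWorld_b15_main_of_leaf θ h hθ (fun _ => W) hγw fun _ => hW⟩

/-- **… W READ AT THE BUNDLE OF RECORD `WOfRecord₁₃ θ.toStage13Params λ`** (dag-n10-d's `Record13Carriers.WOfRecord₁₃` — θ-level, NOT re-issued at v1.6 ∕ v1.7 (node00-def-T g19 Q3; KEYMAP v1.7 §NOT RE-ISSUED): n12-a's `WOfRepr` at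
`Tstep rep_k` of record, the selector and the fibres along the ₁₃ histories): the N12 row HANDED run by run. [cite: Balaban1989LargeFieldI, (0.2)–(0.6) p.176, Prop. 1 p.194, (1.80), (1.89), (1.99)–(1.102); Balaban1989LargeFieldII, Thm 1 + (0.1) pp.355–356 (bookkeeping)] -/
theorem exists_record₁₃CCoPH_pinWWorld_b15_main_of_leafOfRecord (h : θ.Provisos₁₃CoPH F N) (hθ : θ.Admissible F N) (lamW : ResidW F N)
    {γw : ℝ} (hγw : 0 < γw ∧ γw ≤ θ.γ) (h12 : ∀ P, B15Leaf (WOfRecord₁₃ F N θ.toStage13Params lamW P)) :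
    ∃ w : WorldP, IsRecordOfRecord₁₃CCoPH F N (datumOfRecord₁₃CoPH F N θ h) w ∧ w.γ = γw ∧ w.L = (θ.L : ℝ) ∧
      (∀ P, w.up P = upOfRecord₅C F N ((θ.pinW F N (WOfRecord₁₃ F N θ.toStage13Params lamW)).toStage5₁₃CoPH F N) P) ∧
        ∀ P : B12.RunParams, Dag.B15_main (leavesP w P) :=
  exists_record₁₃CCoPH_pinWWorld_b15_main_of_leaf θ h hθ (WOfRecord₁₃ F N θ.toStage13Params lamW) hγw h12

end Storey

/-! ## §2 THE MIXED W-PIN AT THE v1.7 CORE RECORD — the bundle of record below the torus, a degenerate leaf-carrier on runs whose selected step is not a printed step (`P.K ≤ λ.kSel P`):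
N12's storey WITHOUT the `K ≤ kSel P` leaf -/

section BelowTorus
variable (θ : Stage13HParams F N)

/-- **THE MIXED W-PIN ENGINE AT THE v1.7 CORE RECORD**: for every admissible v1.7 Stage-13 package with the core provisos and every residual layer `λ` whose bundle of record carries the
leaf on the runs `P` with `λ.kSel P < P.K` (the runs where step `λ.kSel P` IS one of print's `K` steps), there is a run-indexed [IV] bundle family `W₀` AGREEING WITH THE BUNDLE OF
RECORD `WOfRecord₁₃ θ.toStage13Params λ P` ON THOSE RUNS, carrying the leaf at every run, whose W-pinned world is a v1.7 core record of `datumOfRecord₁₃CoPH θ h` with `Dag.B15_main` at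
every run.  On the other runs (`P.K ≤ λ.kSel P`: at `K = 0` there is no step) `W₀ P` is the degenerate leaf-carrier of this seat's g4 `exists_printedCarriers15_b15Leaf`, where print
applies no basic step.  HONESTY: this removes a junk demand, not a printed one; the per-run cost below the torus is unchanged. [cite: Balaban1989LargeFieldI, (0.1)–(0.6) pp.175–176 (the basic step is applied at the steps `k < K` of a run), Prop. 1 p.194; Balaban1989LargeFieldII, Thm 1 + (0.1) pp.355–356 (bookkeeping)] -/
theorem exists_mixedPinW_record₁₃CCoPH_b15_main_of_leafBelow (h : θ.Provisos₁₃CoPH F N) (hθ : θ.Admissible F N) (lamW : ResidW F N)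
    {γw : ℝ} (hγw : 0 < γw ∧ γw ≤ θ.γ) (h12 : ∀ P : B12.RunParams, lamW.kSel P < P.K → B15Leaf (WOfRecord₁₃ F N θ.toStage13Params lamW P)) :
    ∃ W₀ : B12.RunParams → PrintedCarriers15, (∀ P : B12.RunParams, lamW.kSel P < P.K → W₀ P = WOfRecord₁₃ F N θ.toStage13Params lamW P) ∧ (∀ P, B15Leaf (W₀ P)) ∧
      ∃ w : WorldP, IsRecordOfRecord₁₃CCoPH F N (datumOfRecord₁₃CoPH F N θ h) w ∧ w.γ = γw ∧ w.L = (θ.L : ℝ) ∧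
        (∀ P, w.up P = upOfRecord₅C F N ((θ.pinW F N W₀).toStage5₁₃CoPH F N) P) ∧ ∀ P : B12.RunParams, Dag.B15_main (leavesP w P) := by
  obtain ⟨Wd, hWd⟩ := N12AtRecord12Pointed.exists_printedCarriers15_b15Leaf (F.P 0)
  have hleaf : ∀ P : B12.RunParams, B15Leaf ((fun P : B12.RunParams => if lamW.kSel P < P.K then WOfRecord₁₃ F N θ.toStage13Params lamW P else Wd) P) := fun P => by
    dsimp only
    split_ifs with hP
    exacts [h12 P hP, hWd]
  exact ⟨_, fun P hP => if_pos hP, hleaf, exists_record₁₃CCoPH_pinWWorld_b15_main_of_leaf θ h hθ _ hγw hleaf⟩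

end BelowTorus

/-! ## §3 AT THE H-EXTENSION `⟨⟨Θ.liveRepin₁₃, Zr⟩, Zh, Phih⟩` OF THE LIVE RE-PIN OF A PARAMETER CARRYING K0b's RESIDUALS (dag-n11-e's convention: ALL THREE SLOTS `Zr`, `Zh`, `Phih` FREE, so that
the door-cured pin `Stage13HParams.ofHistoryBlind F N (Stage13RParams.ofCured F N (Θ.liveRepin₁₃ F N))` is an instance by `rfl`) — N12's row from its per-run displays by 12E, since
`(⟨⟨Θ.liveRepin₁₃, Zr⟩, Zh, Phih⟩ : Stage13HParams).toStage13Params = Θ.liveRepin₁₃` by `rfl` -/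

section LiveExtension
variable (Θ : Stage13Params F N) (Zr : (q : B12.RunParams) → TkResidualW F N (FluctV N) q.K)
  (Zh : (q : B12.RunParams) → ℕ → (ℕ → Set (Site (F.P q.K) 0)) → (ℕ → Set (Site (F.P q.K) 0)) → TkResidualW F N (FluctV N) q.K)
  (Phih : (q : B12.RunParams) → ℕ → (ℕ → Set (Site (F.P q.K) 0)) → (ℕ → Set (Site (F.P q.K) 0)) → (ℕ → Plaq (F.P q.K) 0 → ℝ)) (lamW : ResidW F N)

/-- **★ N12's v1.7 CORE STOREY AT THE H-EXTENSION OF THE ₁₃ LIVE RE-PIN, MIXED W-PIN — NO `K ≤ kSel P` LEAF**: at `⟨⟨Θ.liveRepin₁₃, Zr⟩, Zh, Phih⟩` for a `Θ` carrying K0b's residuals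
and ANY residual slots `Zr`, `Zh`, `Phih`, N12's row on the runs below the torus from 12E's per-run ★★ `b15Leaf_WOfRecord₁₃_liveRepin₁₃_of_massLive_of_hasResiduals` (the (1.100) pin equation +
«every LIVE pre-𝐑 term at level `kSel P + 1` has positive mass» + Prop. 1 (1.78) + (1.80) + (1.89)), the other runs served by the degenerate carrier (§2 engine).  Edition-side input:
`h : Provisos₁₃CoPH` AT THE EXTENSION (i.e. `hE.toCore` of the closer's v1.7 package; its rows `zhLaws ∕ zhLocal` are the only clauses reading `Zh` — for the datum and the record predicate
ONLY) and admissibility of `Θ`.  N12 reads no 𝐓-weight (neither `Zr` nor `Zh` nor `Phih`). [cite: Balaban1989LargeFieldI, (0.2)–(0.6) p.176, p.176 ll.14–16, Prop. 1 (1.78) p.194, (1.80) p.195, (1.89) p.198, (1.99)–(1.102) pp.200–201; Balaban1988Convergent, (1.11) p.248, (3.16) p.268, (3.22)–(3.25) pp.269–270; Balaban1989LargeFieldII, Thm 1 + (0.1) pp.355–356] -/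
theorem exists_mixedPinW_record₁₃CCoPH_b15_main_liveRepin₁₃H_of_massLive_of_hasResiduals (hres : Θ.HasResidualsOfRecord F N)
    (h : (⟨⟨Θ.liveRepin₁₃ F N, Zr⟩, Zh, Phih⟩ : Stage13HParams F N).Provisos₁₃CoPH F N) (hθ : Θ.Admissible F N) {γw : ℝ} (hγw : 0 < γw ∧ γw ≤ Θ.γ)
    (h12pin : ∀ P : B12.RunParams, lamW.kSel P < P.K → lamW.D1100 P
      = rPrimeDataOfSel (reprTOfRecord₁₃ F N (Θ.liveRepin₁₃ F N) P (lamW.kSel P))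
          ((Θ.liveRepin₁₃ F N).ppSel P (gOfRecord₁₃ F N (Θ.liveRepin₁₃ F N) P) (lamW.kSel P + 1))
          (fibOfSeq F (Θ.liveRepin₁₃ F N).ν (Θ.liveRepin₁₃ F N).τ9 P (gOfRecord₁₃ F N (Θ.liveRepin₁₃ F N) P) (lamW.kSel P + 1)))
    (h12mass : ∀ P : B12.RunParams, lamW.kSel P < P.K → ∀ s, LiveSeq F N Θ.ν Θ.τ9 P (gOfRecord₁₃ F N (Θ.liveRepin₁₃ F N) P) (lamW.kSel P + 1)
        (slotsTOfRecord F N Θ.ν Θ.τ9 (EOfRecord₁₃ F N (Θ.liveRepin₁₃ F N)) (wOfRecord₉ F N (Θ.liveRepin₁₃ F N).toStage9Params)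
          (Θ.liveRepin₁₃ F N).ppSel P (gOfRecord₁₃ F N (Θ.liveRepin₁₃ F N) P) (lamW.kSel P + 1)) s →
      0 < ∫ V, rterm (reprTOfRecord₁₃ F N (Θ.liveRepin₁₃ F N) P (lamW.kSel P)) s V ∂(fieldMeasure (F.P P.K) (lamW.kSel P + 1) (SU N)))
    (h12P1 : ∀ P : B12.RunParams, lamW.kSel P < P.K → Prop1Printed (lamW.LF P))
    (h12i180 : ∀ P : B12.RunParams, lamW.kSel P < P.K → ∀ U, new189 (lamW.D189 P) U → ∀ i, (lamW.D189 P).h ≤ i → i ≤ (lamW.D189 P).k →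
      ∀ q ∈ plaqsOf (dom (lamW.D189 P) i),
        Ineq180 ((lamW.D189 P).dev0 U q) ((lamW.D189 P).ε (lamW.D189 P).k) (lamW.D189 P).η (lamW.D189 P).B₃ (lamW.D189 P).B₅ (lamW.D189 P).M (lamW.D189 P).δ
          ((lamW.D189 P).dist q) (lamW.D189 P).O1)
    (h12c189 : ∀ P : B12.RunParams, lamW.kSel P < P.K → Claim189 (new189 (lamW.D189 P)) (chiPP (lamW.D189 P))) :
    ∃ W₀ : B12.RunParams → PrintedCarriers15, (∀ P : B12.RunParams, lamW.kSel P < P.K → W₀ P = WOfRecord₁₃ F N (Θ.liveRepin₁₃ F N) lamW P) ∧ (∀ P, B15Leaf (W₀ P)) ∧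
      ∃ w : WorldP, IsRecordOfRecord₁₃CCoPH F N (datumOfRecord₁₃CoPH F N (⟨⟨Θ.liveRepin₁₃ F N, Zr⟩, Zh, Phih⟩ : Stage13HParams F N) h) w ∧ w.γ = γw ∧ w.L = (Θ.L : ℝ) ∧
        (∀ P, w.up P = upOfRecord₅C F N (((⟨⟨Θ.liveRepin₁₃ F N, Zr⟩, Zh, Phih⟩ : Stage13HParams F N).pinW F N W₀).toStage5₁₃CoPH F N) P) ∧
          ∀ P : B12.RunParams, Dag.B15_main (leavesP w P) :=
  exists_mixedPinW_record₁₃CCoPH_b15_main_of_leafBelow (⟨⟨Θ.liveRepin₁₃ F N, Zr⟩, Zh, Phih⟩ : Stage13HParams F N) h hθ.liveRepin₁₃ lamW hγw fun P hk =>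
    b15Leaf_WOfRecord₁₃_liveRepin₁₃_of_massLive_of_hasResiduals Θ lamW hres hk (h12pin P hk) (h12mass P hk) (h12P1 P hk) (h12i180 P hk) (h12c189 P hk)

/-- **★★ THE RUNG-1 ∃-SHAPE AT THE v1.7 CORE RECORD (K1⁷'s guard `ZhUnity ∧ SlotsNondegenerate₁₃` — NOT an item text: items key on the `SepCoPH` edition and bind the world by `RecordS`),
N12's CONJUNCT ONLY, WITNESSED BY `(⟨⟨Θ.liveRepin₁₃, Zr⟩, Zh, Phih⟩, h, w)` — NO `K ≤ kSel P` LEAF**: `∃ θ' h' w, (ZhUnity ∧ SlotsNondegenerate₁₃) ∧ Admissible ∧ IsRecordOfRecord₁₃CCoPH (datumOfRecord₁₃CoPH θ' h') w ∧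
∀ P, Dag.B15_main (leavesP w P)`; the slots guard a THEOREM of K0b's residuals (node00-def-K0a FILE 9 v1.1 `slotsNondegenerate₁₃_liveRepin_of_hasResiduals` — read through `toStage13Params`),
print's partition of unity of the history-indexed residual DISPLAYED (`hZh`; a theorem at the door-cured pin, §4).  N12 ALONE at its own world; NOT the stub; count-neutral.
[cite: Balaban1989LargeFieldI, (0.2)–(0.6) p.176, Prop. 1 (1.78) p.194, (1.80) p.195, (1.89) p.198, (1.99)–(1.102) pp.200–201; Balaban1988Convergent, (1.11) p.248, (3.16)–(3.22) pp.268–269 (the guard); Balaban1989LargeFieldII, Thm 1 + (0.1) pp.355–356 (bookkeeping)] -/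
theorem exists_guarded_record₁₃CCoPH_b15_main_liveRepin₁₃H_of_massLive_of_hasResiduals_below (hres : Θ.HasResidualsOfRecord F N)
    (h : (⟨⟨Θ.liveRepin₁₃ F N, Zr⟩, Zh, Phih⟩ : Stage13HParams F N).Provisos₁₃CoPH F N) (hθ : Θ.Admissible F N) (hZh : (⟨⟨Θ.liveRepin₁₃ F N, Zr⟩, Zh, Phih⟩ : Stage13HParams F N).ZhUnity F N)
    (h12pin : ∀ P : B12.RunParams, lamW.kSel P < P.K → lamW.D1100 P
      = rPrimeDataOfSel (reprTOfRecord₁₃ F N (Θ.liveRepin₁₃ F N) P (lamW.kSel P))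
          ((Θ.liveRepin₁₃ F N).ppSel P (gOfRecord₁₃ F N (Θ.liveRepin₁₃ F N) P) (lamW.kSel P + 1))
          (fibOfSeq F (Θ.liveRepin₁₃ F N).ν (Θ.liveRepin₁₃ F N).τ9 P (gOfRecord₁₃ F N (Θ.liveRepin₁₃ F N) P) (lamW.kSel P + 1)))
    (h12mass : ∀ P : B12.RunParams, lamW.kSel P < P.K → ∀ s, LiveSeq F N Θ.ν Θ.τ9 P (gOfRecord₁₃ F N (Θ.liveRepin₁₃ F N) P) (lamW.kSel P + 1)
        (slotsTOfRecord F N Θ.ν Θ.τ9 (EOfRecord₁₃ F N (Θ.liveRepin₁₃ F N)) (wOfRecord₉ F N (Θ.liveRepin₁₃ F N).toStage9Params)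
          (Θ.liveRepin₁₃ F N).ppSel P (gOfRecord₁₃ F N (Θ.liveRepin₁₃ F N) P) (lamW.kSel P + 1)) s →
      0 < ∫ V, rterm (reprTOfRecord₁₃ F N (Θ.liveRepin₁₃ F N) P (lamW.kSel P)) s V ∂(fieldMeasure (F.P P.K) (lamW.kSel P + 1) (SU N)))
    (h12P1 : ∀ P : B12.RunParams, lamW.kSel P < P.K → Prop1Printed (lamW.LF P))
    (h12i180 : ∀ P : B12.RunParams, lamW.kSel P < P.K → ∀ U, new189 (lamW.D189 P) U → ∀ i, (lamW.D189 P).h ≤ i → i ≤ (lamW.D189 P).k →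
      ∀ q ∈ plaqsOf (dom (lamW.D189 P) i),
        Ineq180 ((lamW.D189 P).dev0 U q) ((lamW.D189 P).ε (lamW.D189 P).k) (lamW.D189 P).η (lamW.D189 P).B₃ (lamW.D189 P).B₅ (lamW.D189 P).M (lamW.D189 P).δ
          ((lamW.D189 P).dist q) (lamW.D189 P).O1)
    (h12c189 : ∀ P : B12.RunParams, lamW.kSel P < P.K → Claim189 (new189 (lamW.D189 P)) (chiPP (lamW.D189 P))) :
    ∃ (θ' : Stage13HParams F N) (h' : θ'.Provisos₁₃CoPH F N) (w : WorldP), (θ'.ZhUnity F N ∧ θ'.SlotsNondegenerate₁₃ F N) ∧ θ'.Admissible F N ∧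
      IsRecordOfRecord₁₃CCoPH F N (datumOfRecord₁₃CoPH F N θ' h') w ∧ ∀ P : B12.RunParams, Dag.B15_main (leavesP w P) := by
  obtain ⟨-, -, -, w, hR, -, -, -, hN⟩ := exists_mixedPinW_record₁₃CCoPH_b15_main_liveRepin₁₃H_of_massLive_of_hasResiduals Θ Zr Zh Phih lamW hres h hθ
    ⟨hθ.toStage9.gamma_pos, le_rfl⟩ h12pin h12mass h12P1 h12i180 h12c189
  exact ⟨(⟨⟨Θ.liveRepin₁₃ F N, Zr⟩, Zh, Phih⟩ : Stage13HParams F N), h, w, ⟨hZh, Stage13Params.slotsNondegenerate₁₃_liveRepin_of_hasResiduals hres⟩, hθ.liveRepin₁₃, hR, hN⟩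

end LiveExtension

/-! ## §4 AT THE DOOR-CURED PIN `Stage13HParams.ofHistoryBlind F N (Stage13RParams.ofCured F N (Θ.liveRepin₁₃ F N))` (node00-def-T FILE 27 §H1 door ∘ node00-def-K0a FILE 18 cured pin `⟨Θ.liveRepin₁₃, ZrOfRecord₁₃ F N (Θ.liveRepin₁₃)⟩` — K0b FILE 17's run-indexed residual of
record, dag-n11-d's diagonal cure; `Zh p n Ω Λ := Zr p`, `Phih p n Ω Λ := (Rz p.K).phi`): `ZhUnity` a THEOREM (`ZrUnity.ofHistoryBlind` ∘ `zrUnity_ofCured`), the v1.7 core provisos from the v1.5 ones (`Provisos₁₃Core.ofCured`, then `Provisos₁₃CoPR.ofHistoryBlind`) -/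

section Cured
variable (Θ : Stage13Params F N) (lamW : ResidW F N)

/-- **★★ THE RUNG-1 ∃-SHAPE AT THE v1.7 CORE RECORD, N12's CONJUNCT ONLY, WITNESSED AT THE DOOR-CURED PIN OF THE LIVE RE-PIN — `ZhUnity` DISCHARGED** (node00-def-K0a's
`zrUnity_ofCured` through node00-def-T's `ZrUnity.ofHistoryBlind`, hypothesis-free; the witness is §3's ★★ at `Zr := ZrOfRecord₁₃ F N (Θ.liveRepin₁₃ F N)`, `Zh := fun p _ _ _ => Zr p`, `Phih := fun p _ _ _ => (Rz p.K).phi`, `rfl`): EDITION-SIDE INPUT = the v1.5 core package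
`h : (Θ.liveRepin₁₃).Provisos₁₃Core` (lifted by K0a's `Provisos₁₃Core.ofCured` and def-T's `Provisos₁₃CoPR.ofHistoryBlind`; read by the datum and the record predicate only) and admissibility of `Θ` — AT THE DOOR-CURED PIN N12's v1.7
STOREY COSTS EXACTLY ITS v1.5 INPUTS (12J-CoP ★★): N12's per-run displays below the torus.  N12 ALONE; NOT the stub; count-neutral.
[cite: Balaban1989LargeFieldI, (0.2)–(0.6) p.176, Prop. 1 (1.78) p.194, (1.80) p.195, (1.89) p.198, (1.99)–(1.102) pp.200–201; Balaban1988Convergent, (1.11) p.248, (3.16)–(3.22) pp.268–269; Balaban1989LargeFieldII, Thm 1 + (0.1) pp.355–356 (bookkeeping)] -/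
theorem exists_guarded_record₁₃CCoPH_b15_main_ofHistoryBlind_ofCured_liveRepin₁₃_of_massLive_of_hasResiduals_below (hres : Θ.HasResidualsOfRecord F N)
    (h : (Θ.liveRepin₁₃ F N).Provisos₁₃Core F N) (hθ : Θ.Admissible F N)
    (h12pin : ∀ P : B12.RunParams, lamW.kSel P < P.K → lamW.D1100 P
      = rPrimeDataOfSel (reprTOfRecord₁₃ F N (Θ.liveRepin₁₃ F N) P (lamW.kSel P))
          ((Θ.liveRepin₁₃ F N).ppSel P (gOfRecord₁₃ F N (Θ.liveRepin₁₃ F N) P) (lamW.kSel P + 1))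
          (fibOfSeq F (Θ.liveRepin₁₃ F N).ν (Θ.liveRepin₁₃ F N).τ9 P (gOfRecord₁₃ F N (Θ.liveRepin₁₃ F N) P) (lamW.kSel P + 1)))
    (h12mass : ∀ P : B12.RunParams, lamW.kSel P < P.K → ∀ s, LiveSeq F N Θ.ν Θ.τ9 P (gOfRecord₁₃ F N (Θ.liveRepin₁₃ F N) P) (lamW.kSel P + 1)
        (slotsTOfRecord F N Θ.ν Θ.τ9 (EOfRecord₁₃ F N (Θ.liveRepin₁₃ F N)) (wOfRecord₉ F N (Θ.liveRepin₁₃ F N).toStage9Params)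
          (Θ.liveRepin₁₃ F N).ppSel P (gOfRecord₁₃ F N (Θ.liveRepin₁₃ F N) P) (lamW.kSel P + 1)) s →
      0 < ∫ V, rterm (reprTOfRecord₁₃ F N (Θ.liveRepin₁₃ F N) P (lamW.kSel P)) s V ∂(fieldMeasure (F.P P.K) (lamW.kSel P + 1) (SU N)))
    (h12P1 : ∀ P : B12.RunParams, lamW.kSel P < P.K → Prop1Printed (lamW.LF P))
    (h12i180 : ∀ P : B12.RunParams, lamW.kSel P < P.K → ∀ U, new189 (lamW.D189 P) U → ∀ i, (lamW.D189 P).h ≤ i → i ≤ (lamW.D189 P).k →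
      ∀ q ∈ plaqsOf (dom (lamW.D189 P) i),
        Ineq180 ((lamW.D189 P).dev0 U q) ((lamW.D189 P).ε (lamW.D189 P).k) (lamW.D189 P).η (lamW.D189 P).B₃ (lamW.D189 P).B₅ (lamW.D189 P).M (lamW.D189 P).δ
          ((lamW.D189 P).dist q) (lamW.D189 P).O1)
    (h12c189 : ∀ P : B12.RunParams, lamW.kSel P < P.K → Claim189 (new189 (lamW.D189 P)) (chiPP (lamW.D189 P))) :
    ∃ (θ' : Stage13HParams F N) (h' : θ'.Provisos₁₃CoPH F N) (w : WorldP), (θ'.ZhUnity F N ∧ θ'.SlotsNondegenerate₁₃ F N) ∧ θ'.Admissible F N ∧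
      IsRecordOfRecord₁₃CCoPH F N (datumOfRecord₁₃CoPH F N θ' h') w ∧ ∀ P : B12.RunParams, Dag.B15_main (leavesP w P) :=
  exists_guarded_record₁₃CCoPH_b15_main_liveRepin₁₃H_of_massLive_of_hasResiduals_below Θ (ZrOfRecord₁₃ F N (Θ.liveRepin₁₃ F N)) (fun p _ _ _ => (Stage13RParams.ofCured F N (Θ.liveRepin₁₃ F N)).Zr p)
    (fun p _ _ _ => ((Stage13RParams.ofCured F N (Θ.liveRepin₁₃ F N)).Rz p.K).phi) lamW hres h.ofCured.ofHistoryBlind hθ (Stage13RParams.zrUnity_ofCured (Θ.liveRepin₁₃ F N)).ofHistoryBlind h12pin h12mass h12P1 h12i180 h12c189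

end Cured

/-! ## §5 AT THE DOOR-CURED PIN OF THE PLAN's `L`-KEYED WITNESS `θ₁₅ᶜ = theta13OfThm1C F N ε₀ ε₂₉ B₃ a₀ a₁` -/

section CuredThm1C
variable (ε₀ ε₂₉ B₃ a₀ a₁ : ℝ) (lamW : ResidW F N)

/-- **★★★ THE RUNG-1 ∃-SHAPE AT THE v1.7 CORE RECORD, N12's CONJUNCT ONLY, AT THE DOOR-CURED PIN OF THE PLAN's WITNESS `Stage13HParams.ofHistoryBlind F N (Stage13RParams.ofCured F N θ₁₅ᶜ)`,
`θ₁₅ᶜ = theta13OfThm1C F N ε₀ ε₂₉ B₃ a₀ a₁`** (§4 at `Θ := theta13OfNumerics … (stage12NumericsOfThm1C F.L ε₀ B₃ a₀ a₁) …`, whose ₁₃ live re-pin IS `θ₁₅ᶜ`; K0b's residuals by K0a's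
`hasResidualsOfRecord_theta13OfNumerics`, admissibility by `admissible_theta13OfNumerics` under the five witness signs; `ZhUnity` by `(zrUnity_ofCured _).ofHistoryBlind`): EDITION-SIDE INPUT = the v1.5
`h : Provisos₁₃Core θ₁₅ᶜ` ALONE.  (The K0⁶ witnesses of record ARE cured pins of such live families — K0a FILE 18 §3–§4 — and their door images are the K0⁷ ones: dag-lead, bridge ⁷ ⇐ ⁶.)  N12 ALONE; NOT the stub; count-neutral. [cite: Balaban1989LargeFieldI, (0.2)–(0.6) p.176, Prop. 1 (1.78) p.194, (1.80) p.195, (1.89) p.198, (1.99)–(1.102) pp.200–201; Balaban1988Convergent, (1.11) p.248, (2.10) p.256, (3.16)–(3.22) pp.268–269; Balaban1989LargeFieldII, Thm 1 + (0.1) pp.355–356; Balaban1985Variational, Thm 1 p.279 (witness letters only)] -/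
theorem exists_guarded_record₁₃CCoPH_b15_main_ofHistoryBlind_ofCured_theta13OfThm1C_of_massLive_below (hε : 0 < ε₀) (hε' : 0 < ε₂₉) (hB : 0 ≤ B₃) (ha₀ : 0 < a₀) (ha₁ : 0 < a₁)
    (h : (theta13OfThm1C F N ε₀ ε₂₉ B₃ a₀ a₁).Provisos₁₃Core F N)
    (h12pin : ∀ P : B12.RunParams, lamW.kSel P < P.K → lamW.D1100 P
      = rPrimeDataOfSel (reprTOfRecord₁₃ F N (theta13OfThm1C F N ε₀ ε₂₉ B₃ a₀ a₁) P (lamW.kSel P))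
          ((theta13OfThm1C F N ε₀ ε₂₉ B₃ a₀ a₁).ppSel P (gOfRecord₁₃ F N (theta13OfThm1C F N ε₀ ε₂₉ B₃ a₀ a₁) P) (lamW.kSel P + 1))
          (fibOfSeq F (theta13OfThm1C F N ε₀ ε₂₉ B₃ a₀ a₁).ν (theta13OfThm1C F N ε₀ ε₂₉ B₃ a₀ a₁).τ9 P (gOfRecord₁₃ F N (theta13OfThm1C F N ε₀ ε₂₉ B₃ a₀ a₁) P) (lamW.kSel P + 1)))
    (h12mass : ∀ P : B12.RunParams, lamW.kSel P < P.K → ∀ s, LiveSeq F N (theta13OfThm1C F N ε₀ ε₂₉ B₃ a₀ a₁).ν (theta13OfThm1C F N ε₀ ε₂₉ B₃ a₀ a₁).τ9 P (gOfRecord₁₃ F N (theta13OfThm1C F N ε₀ ε₂₉ B₃ a₀ a₁) P) (lamW.kSel P + 1)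
        (slotsTOfRecord F N (theta13OfThm1C F N ε₀ ε₂₉ B₃ a₀ a₁).ν (theta13OfThm1C F N ε₀ ε₂₉ B₃ a₀ a₁).τ9 (EOfRecord₁₃ F N (theta13OfThm1C F N ε₀ ε₂₉ B₃ a₀ a₁)) (wOfRecord₉ F N (theta13OfThm1C F N ε₀ ε₂₉ B₃ a₀ a₁).toStage9Params)
          (theta13OfThm1C F N ε₀ ε₂₉ B₃ a₀ a₁).ppSel P (gOfRecord₁₃ F N (theta13OfThm1C F N ε₀ ε₂₉ B₃ a₀ a₁) P) (lamW.kSel P + 1)) s →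
      0 < ∫ V, rterm (reprTOfRecord₁₃ F N (theta13OfThm1C F N ε₀ ε₂₉ B₃ a₀ a₁) P (lamW.kSel P)) s V ∂(fieldMeasure (F.P P.K) (lamW.kSel P + 1) (SU N)))
    (h12P1 : ∀ P : B12.RunParams, lamW.kSel P < P.K → Prop1Printed (lamW.LF P))
    (h12i180 : ∀ P : B12.RunParams, lamW.kSel P < P.K → ∀ U, new189 (lamW.D189 P) U → ∀ i, (lamW.D189 P).h ≤ i → i ≤ (lamW.D189 P).k →
      ∀ q ∈ plaqsOf (dom (lamW.D189 P) i),
        Ineq180 ((lamW.D189 P).dev0 U q) ((lamW.D189 P).ε (lamW.D189 P).k) (lamW.D189 P).η (lamW.D189 P).B₃ (lamW.D189 P).B₅ (lamW.D189 P).M (lamW.D189 P).δ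
          ((lamW.D189 P).dist q) (lamW.D189 P).O1)
    (h12c189 : ∀ P : B12.RunParams, lamW.kSel P < P.K → Claim189 (new189 (lamW.D189 P)) (chiPP (lamW.D189 P))) :
    ∃ (θ' : Stage13HParams F N) (h' : θ'.Provisos₁₃CoPH F N) (w : WorldP), (θ'.ZhUnity F N ∧ θ'.SlotsNondegenerate₁₃ F N) ∧ θ'.Admissible F N ∧
      IsRecordOfRecord₁₃CCoPH F N (datumOfRecord₁₃CoPH F N θ' h') w ∧ ∀ P : B12.RunParams, Dag.B15_main (leavesP w P) :=
  exists_guarded_record₁₃CCoPH_b15_main_ofHistoryBlind_ofCured_liveRepin₁₃_of_massLive_of_hasResiduals_below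
    (theta13OfNumerics F N (stage12NumericsOfThm1C F.L ε₀ B₃ a₀ a₁) ε₂₉
      (zeta316OfRecord F N (stage12NumericsOfThm1C F.L ε₀ B₃ a₀ a₁).ν (stage12NumericsOfThm1C F.L ε₀ B₃ a₀ a₁).τ9.M (stage12NumericsOfThm1C F.L ε₀ B₃ a₀ a₁).A₁)
      (RzOfRecord F N) (ZtOfRecord F N)) lamW
    (hasResidualsOfRecord_theta13OfNumerics F N (stage12NumericsOfThm1C F.L ε₀ B₃ a₀ a₁) ε₂₉) h
    (admissible_theta13OfNumerics F N (zeta316OfRecord F N (stage12NumericsOfThm1C F.L ε₀ B₃ a₀ a₁).ν (stage12NumericsOfThm1C F.L ε₀ B₃ a₀ a₁).τ9.M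
      (stage12NumericsOfThm1C F.L ε₀ B₃ a₀ a₁).A₁) (RzOfRecord F N) (ZtOfRecord F N) (stage12NumericsOfThm1C_pos hε hB ha₀ ha₁) hε')
    h12pin h12mass h12P1 h12i180 h12c189

end CuredThm1C

end Summit.QuantumFields.YangMills.BalabanUVNodes.N12AtRecord13CoPH
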